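import Summits.CriticalPhenomena.PercolationContinuityZ3.Theorems.PercNearOneGluingNoHeavyLowerTailSahiE3ProdRow03UnionDefs
import Mathlib.Data.Real.Basic
import Mathlib.Data.Fin.VecNotation
import Mathlib.Tactic.Ring
import Mathlib.Tactic.LinearCombination
import HarnessLib

/-!
# `NoHeavyLowerTail` (crux stmt-CriticalPhenomena-4575), Sahi programme P4 — product-row rung `E₃(u₀u₃,u₁,u₂)`: basic lemmas

Support file (cell `prim-l12`, seat P4, generation 38; `--supports stmt-CriticalPhenomena-4575`).  No definitions, no named facts, no sorries.
`phi03` (`…SahiE3ProdRow03UnionDefs`) is affine along every direction of the four slicings `Z, W₀, W₁, W₂` of the block moments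
(multi-affinity with the disjointness rule), and it is invariant under the simultaneous relabelling `1 ↔ 2` of the members on both sides
(the only symmetry of the product row `E₃(u₀u₃,u₁,u₂)` that fixes the block). [this work]
-/

namespace Summit.CriticalPhenomena.PercolationContinuityZ3.Theorems.SahiE3ProdRow03Union

open Summit.CriticalPhenomena.PercolationContinuityZ3.Theorems.SahiE4UnionThree

section affine
variable (m d : Fin 7 → ℝ)

set_option maxRecDepth 8000 in
/-- `phi03` is affine along a direction of the slicing `Z`. [this work] -/
theorem phi03_affine_Z (t : Fin 15 → ℝ) (hd : sliceZ d) (s : ℝ) :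
    phi03 t (m + s • d) = phi03 t m + s * (phi03 t (m + d) - phi03 t m) := by
  rcases hd with ⟨h1, h2, h3⟩
  unfold phi03
  simp only [Pi.add_apply, Pi.smul_apply, smul_eq_mul, h1, h2, h3]
  ring

set_option maxRecDepth 8000 in
/-- `phi03` is affine along a direction of the slicing `W0`. [this work] -/
theorem phi03_affine_W0 (t : Fin 15 → ℝ) (hd : sliceW0 d) (s : ℝ) :
    phi03 t (m + s • d) = phi03 t m + s * (phi03 t (m + d) - phi03 t m) := by
  rcases hd with ⟨h1, h2, h3⟩
  unfold phi03
  simp only [Pi.add_apply, Pi.smul_apply, smul_eq_mul, h1, h2, h3]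
  ring

set_option maxRecDepth 8000 in
/-- `phi03` is affine along a direction of the slicing `W1`. [this work] -/
theorem phi03_affine_W1 (t : Fin 15 → ℝ) (hd : sliceW1 d) (s : ℝ) :
    phi03 t (m + s • d) = phi03 t m + s * (phi03 t (m + d) - phi03 t m) := by
  rcases hd with ⟨h1, h2, h3⟩
  unfold phi03
  simp only [Pi.add_apply, Pi.smul_apply, smul_eq_mul, h1, h2, h3]
  ring

set_option maxRecDepth 8000 in
/-- `phi03` is affine along a direction of the slicing `W2`. [this work] -/
theorem phi03_affine_W2 (t : Fin 15 → ℝ) (hd : sliceW2 d) (s : ℝ) :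
    phi03 t (m + s • d) = phi03 t m + s * (phi03 t (m + d) - phi03 t m) := by
  rcases hd with ⟨h1, h2, h3⟩
  unfold phi03
  simp only [Pi.add_apply, Pi.smul_apply, smul_eq_mul, h1, h2, h3]
  ring

end affine

set_option maxRecDepth 8000 in
/-- `phi03` is invariant under the simultaneous relabelling `1 ↔ 2` of the members on both sides. [this work] -/
theorem phi03_swap12 (t : Fin 15 → ℝ) (m : Fin 7 → ℝ) : phi03 (aswap12 t) (bswap12 m) = phi03 t m := by
  unfold phi03
  simp [aswap12, bswap12]
  ring

end Summit.CriticalPhenomena.PercolationContinuityZ3.Theorems.SahiE3ProdRow03Union
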